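import Summits.HodgeConjecture.CorCM.CMSixfoldRank.SimpleCMSixfoldDivisorGenerated
import Literature.AlgebraicGeometry.Motives.AbelianVarietySimpleFactorsUnique
import Literature.AlgebraicGeometry.Pohlmann1968.MumfordSimpleFourfoldOfPrimitive
import Literature.NumberTheory.ComplexMultiplication.ShimuraTaniyamaHecke
import HarnessLib

/-!
# A balanced quadratic endomorphism forces a DEGENERATE type: on a simple CM sixfold
# `B(X) = D(X) ⟺ ¬ HasBalancedQuadraticEndomorphism X`

Cell `pub-hodgecm2` (COR-CM), count-neutral literature seat `lit-deligne-3` gen 5; KERNEL ONLY (theorems; no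
definition, no named fact, `HC_CM` not used).  The converse of `(G₀)` (`SimpleCMSixfoldNondegenerateHodge`).
* §1 (any CM field, any SIMPLE principal realisation): **`exists_iota_eq_of_isSimple`** — `End(A) = ι(𝓞_K)`: `ι` extends
  to `i : K → End⁰(A)` (Serre–Tate, `exists_ringHom_endAlgebra`), injective and onto (`dim_ℚ End⁰(A) = 2 dim A = [K:ℚ]`,
  Shimura §5.1 Props. 3–6, `IsOfCMType.isOfCMTypeSimple`); endomorphisms are integral over `ℤ` (Mumford §19 Thm. 3,
  `module_finite_hom_holds`), so preimages lie in the maximal order; `End ↪ End⁰`.  `iota_injective_of_isSimple`.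
* §2 ([K:ℚ] = 12, Φ primitive): **`not_isNondegenerate_of_hasBalancedQuadraticEndomorphism`** — `φ = ι(w)`, `w² = -d`;
  `Δ = {s | s(w) = i√d}` is a balanced `6`-set (`|τΦ ∩ Δ| = 3` for all `τ ∈ Aut(ℂ)`, from `n_{i√d} = |Φ ∩ Δ| = 3`,
  `|Φ| = |Δ| = 6`) containing `s` but not `s̄`, hence indexes an exceptional class (`exists_exceptional_iff_of_primitive`):
  `B³ ≠ D³`, `Φ` degenerate.  `hasBalancedQuadraticEndomorphism_iff_not_isNondegenerate`.
* §3 on the VARIETY (`X` simple, `IsOfCMType X`, `dim X = 6`): **`isDivisorGenerated_iff_not_hasBalancedQuadraticEndomorphism`**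
  (Moonen–Zarhin's fourfold theorem 2.4 for simple CM SIXFOLDS: exceptional Hodge classes iff an imaginary quadratic
  field acts with multiplicities `(3,3)`), `…_iff_mtRank_eq_six`, `…_iff_exists_exceptional_three`.

## References
* [Shimura1998] G. Shimura, *Abelian varieties with complex multiplication and modular functions*, §5.1 Props. 3–6, §8.2 Prop. 26.
* [MumfordAV1970] D. Mumford, *Abelian Varieties*, §19 Thm. 3, Cor. 1–2.  [SerreTate1968] J.-P. Serre, J. Tate, §4.
* [MoonenZarhin1995Duke] B. Moonen, Yu. Zarhin, Duke Math. J. 77 (1995), Thm. 2.4.  [MoonenZarhin1999LowDim] §5.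
* [Gordon1999HodgeAVSurvey] B. B. Gordon, 5.13, Thm. 6.4, 9.4.  [Pohlmann1968] H. Pohlmann, Ann. of Math. 88 (1968), Thm. 1.
-/

noncomputable section

open CategoryTheory NumberField
open scoped BigOperators Pointwise Classical

namespace Summit.HodgeConjecture.CorCM.CMSixfoldRank

open Literature.NumberTheory.ComplexMultiplication
open Literature.AlgebraicGeometry Literature.AlgebraicGeometry.Motives
open Literature.AlgebraicGeometry.Motives.AbelianVariety
open Literature.AlgebraicGeometry.HodgeTheory
open Literature.AlgebraicGeometry.Pohlmann1968
open Literature.AlgebraicGeometry.ComplexMultiplication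
open Literature.AlgebraicGeometry.Milne1999
open Literature.AlgebraicGeometry.VanGeemen1994 (hodgeClassSpan)
open Literature.Barriers.HodgeConjecture (divisorClassesSpan)
open Summit.HodgeConjecture.HodgeConjecture.Ring2.Atlas

/-! ### §1 `End(A) = ι(𝓞_K)` for a simple principal realisation -/

section EndRing

variable {K : Type} [Field K] [NumberField K] {Φ : CMType K}
variable {A : AbelianVariety ℂ} {ι : 𝓞 K →+* End A} {θ : K →+* Module.End ℂ (complexBetti A.X 1)}

/-- **`End(A) = ι(𝓞_K)` for a SIMPLE principal realisation `(A, ι, θ)` of a CM type of `K`**: every endomorphism of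
`A` is `ι(w)` for some `w ∈ 𝓞_K`.  Serre–Tate's datum `i : K → End⁰(A)` extending `ι` is injective and onto
(`dim_ℚ End⁰(A) = 2 dim A = [K:ℚ]`, Shimura §5.1 Props. 3–6); an endomorphism is integral over `ℤ` (Mumford §19
Thm. 3), so its preimage under `i` lies in the maximal order `𝓞_K`. [cite: Shimura1998, §5.1 Props. 3–6]
[cite: SerreTate1968, §4] [cite: MumfordAV1970, §19 Thm. 3 and Cor. 2] -/
theorem exists_iota_eq_of_isSimple (hA : IsCMTypeRealisation Φ A ι θ) (hs : A.IsSimple) (φ : End A) :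
    ∃ w : 𝓞 K, ι w = φ := by
  obtain ⟨i, hi⟩ := exists_ringHom_endAlgebra (A₀ := A) ι
  have hK2 : Module.finrank ℚ K = 2 * A.dim := finrank_eq_two_mul_dim_of_isCMTypeRealisation hA
  have hpos : 0 < A.dim := by have h : 0 < Module.finrank ℚ K := Module.finrank_pos; omega
  obtain ⟨hF, hrk⟩ := (isOfCMType_of_isCMTypeRealisation hA).isOfCMTypeSimple hs hpos
  haveI : Nontrivial A.endAlgebra := ⟨hF.exists_pair_ne⟩
  have hinj : Function.Injective i := i.injective
  have heq : Module.finrank ℚ K = Module.finrank ℚ A.endAlgebra := by rw [hrk, hK2]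
  have hfin : Module.Finite ℚ A.endAlgebra := finiteDimensional_endAlgebra_holds A
  -- (`Module ℚ End⁰(A)` is found only through `Algebra ℚ End⁰(A)`: instances passed explicitly)
  have hsurj : Function.Surjective i :=
    (@LinearMap.injective_iff_surjective_of_finrank_eq_finrank ℚ K _ _ _ A.endAlgebra _
      Algebra.toModule _ hfin heq i.toRatAlgHom.toLinearMap).1 hinj
  obtain ⟨x, hx⟩ := hsurj (endAlgebra.of A φ)
  -- `φ`, hence `x`, is integral over `ℤ`
  have hφint : IsIntegral ℤ φ := by
    have h : Module.Finite ℤ (A ⟶ A) := module_finite_hom_holds A A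
    have e : (Algebra.toModule : Module ℤ (End A)) = AddCommGroup.toIntModule (A ⟶ A) :=
      Subsingleton.elim _ _
    haveI : @Module.Finite ℤ (End A) _ _ Algebra.toModule := by rw [e]; exact h
    exact Algebra.IsIntegral.isIntegral (R := ℤ) φ
  obtain ⟨p, hp, hpφ⟩ := hφint
  have hxint : IsIntegral ℤ x := by
    refine ⟨p, hp, hinj ?_⟩
    rw [map_zero, Polynomial.hom_eval₂, hx,
      RingHom.ext_int (i.comp (algebraMap ℤ K)) ((endAlgebra.of A).comp (algebraMap ℤ (End A))),
      ← Polynomial.hom_eval₂, hpφ, map_zero]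
  refine ⟨⟨x, (mem_integralClosure_iff ℤ K).2 hxint⟩, ?_⟩
  apply endAlgebra.of_injective_of_charZero (A := A)
  rw [← hi, ← hx]
  rfl

/-- **`ι : 𝓞_K → End(A)` is injective** on a simple principal realisation (`i : K → End⁰(A)` is a ring map out of a
field into a non-zero ring). [cite: Shimura1998, §5.1 Props. 3–6] [cite: SerreTate1968, §4] -/
theorem iota_injective_of_isSimple (hA : IsCMTypeRealisation Φ A ι θ) (hs : A.IsSimple) :
    Function.Injective ι := by
  obtain ⟨i, hi⟩ := exists_ringHom_endAlgebra (A₀ := A) ι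
  have hK2 : Module.finrank ℚ K = 2 * A.dim := finrank_eq_two_mul_dim_of_isCMTypeRealisation hA
  have hpos : 0 < A.dim := by have h : 0 < Module.finrank ℚ K := Module.finrank_pos; omega
  obtain ⟨hF, -⟩ := (isOfCMType_of_isCMTypeRealisation hA).isOfCMTypeSimple hs hpos
  haveI : Nontrivial A.endAlgebra := ⟨hF.exists_pair_ne⟩
  intro a b hab
  have h1 : i (algebraMap (𝓞 K) K a) = i (algebraMap (𝓞 K) K b) := by rw [hi, hi, hab]
  exact IsFractionRing.injective (𝓞 K) K (i.injective h1)

end EndRing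

/-! ### §2 Degree `12`: a balanced quadratic endomorphism makes the type degenerate -/

section Degenerate

variable {K : Type} [Field K] [NumberField K] [IsCMField K] {Φ : CMType K}
variable {A : AbelianVariety ℂ} {ι : 𝓞 K →+* End A} {θ : K →+* Module.End ℂ (complexBetti A.X 1)}

omit [IsCMField K] in
/-- `s(w) = ± i√d` for every embedding `s` when `w² = -d`. [folklore] -/
private theorem apply_eq_or_eq_neg_of_sq_eq_neg {w : K} {d : ℕ} (hw2 : w ^ 2 = -(d : K)) (s : K →+* ℂ) :
    s w = Complex.I * (Real.sqrt d : ℂ) ∨ s w = -(Complex.I * (Real.sqrt d : ℂ)) := by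
  have h : (s w) ^ 2 = (Complex.I * (Real.sqrt d : ℂ)) ^ 2 := by
    rw [← map_pow, hw2, map_neg, map_natCast, I_mul_sqrt_sq]
  exact sq_eq_sq_iff_eq_or_eq_neg.1 h

omit [IsCMField K] in
/-- `s̄(w) = -s(w)` when `w² = -d`. [folklore] -/
private theorem conjugate_apply_eq_neg_of_sq_eq_neg {w : K} {d : ℕ} (hw2 : w ^ 2 = -(d : K)) (s : K →+* ℂ) :
    ComplexEmbedding.conjugate s w = -s w := by
  rw [ComplexEmbedding.conjugate_coe_eq]
  rcases apply_eq_or_eq_neg_of_sq_eq_neg hw2 s with h | h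
  · rw [h, map_mul, Complex.conj_I, Complex.conj_ofReal, neg_mul]
  · rw [h, map_neg, map_mul, Complex.conj_I, Complex.conj_ofReal, neg_mul]

omit [IsCMField K] in
/-- A transversal `S ⊆ Hom(K, ℂ)` (`s ∈ S ↔ s̄ ∉ S`) has `[K:ℚ]/2` elements: `s ↦ s̄` maps `S` onto its complement.
[folklore] -/
private theorem two_mul_ncard_of_transversal {S : Set (K →+* ℂ)}
    (hS : ∀ s : K →+* ℂ, s ∈ S ↔ ComplexEmbedding.conjugate s ∉ S) : 2 * S.ncard = Module.finrank ℚ K := by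
  have himg : ComplexEmbedding.conjugate '' S = Sᶜ := by
    ext t
    constructor
    · rintro ⟨s, hs, rfl⟩
      exact (hS s).1 hs
    · intro ht
      refine ⟨ComplexEmbedding.conjugate t, ?_, star_star t⟩
      by_contra h
      have h1 := hS (ComplexEmbedding.conjugate t)
      rw [show ComplexEmbedding.conjugate (ComplexEmbedding.conjugate t) = t from star_star t] at h1
      exact ht (by_contra fun ht' => h (h1.2 ht'))
  have h1 : Sᶜ.ncard = S.ncard := by
    rw [← himg]
    exact Set.ncard_image_of_injective S star_injective
  have h2 := Set.ncard_add_ncard_compl S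
  rw [h1, Nat.card_eq_fintype_card, Embeddings.card K ℂ] at h2
  omega

/-- **A balanced quadratic endomorphism on a realisation of a PRIMITIVE CM type of a CM field of degree `12` makes the
type DEGENERATE.**  Write `φ = ι(w)` (`exists_iota_eq_of_isSimple`; the realisation is simple by Shimura Prop. 26),
`w² = -d`; `Δ = {s | s(w) = i√d}` is a balanced `6`-set (`|τΦ ∩ Δ| = 3 = |τΦ ∖ Δ|` for every `τ ∈ Aut(ℂ)`, since
`τ(i√d) = ± i√d`, `n_{i√d}(φ) = |Φ ∩ Δ| = 3` and `|Φ| = |Δ| = 6`) which contains some `s` but not `s̄`; for a primitive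
type such a set indexes an EXCEPTIONAL class in `H⁶(A)` (Pohlmann, `exists_exceptional_iff_of_primitive`), so
`B³(A) ≠ D³(A)` and `Φ` is degenerate (Hazama / White). [cite: MoonenZarhin1999LowDim, §5]
[cite: Gordon1999HodgeAVSurvey, 5.13 (ii) and Thm. 6.4] [cite: Pohlmann1968, Thm. 1] -/
theorem not_isNondegenerate_of_hasBalancedQuadraticEndomorphism (hK : Module.finrank ℚ K = 12) (φ₀ : K →+* ℂ)
    (hprim : IsPrimitive (ℂ ≃+* ℂ) Φ.1 φ₀) (hA : IsCMTypeRealisation Φ A ι θ)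
    (hb : HasBalancedQuadraticEndomorphism A) : ¬ IsNondegenerate Φ := by
  haveI := isPretransitive_ringEquiv_complex (K := K)
  have hprim' := (isPrimitive_iff_forall_eq Φ.1 φ₀).1 hprim
  have hs : A.IsSimple := isSimple_of_isCMTypeRealisation_of_primitive hA hprim'
  obtain ⟨φ, d, hd, hφ2, hm⟩ := hb
  obtain ⟨w, hw⟩ := exists_iota_eq_of_isSimple hA hs φ
  -- `w² = -d` in `𝓞_K`, in `K`
  have hw2O : w ^ 2 = -(d : 𝓞 K) := by
    apply iota_injective_of_isSimple hA hs
    rw [map_pow, map_neg, map_natCast, sq, hw, End.mul_def, hφ2, ← nsmul_one d]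
    rfl
  have hw2 : (w : K) ^ 2 = -(d : K) := by
    have h := congrArg (algebraMap (𝓞 K) K) hw2O
    rwa [map_pow, map_neg, map_natCast] at h
  -- notation: `ρ = i√d`, the level sets `S ε = {t | t(w) = ε}`
  set ρ : ℂ := Complex.I * (Real.sqrt d : ℂ) with hρ
  have hρ0 : ρ ≠ 0 := I_mul_sqrt_ne_zero hd
  have hρne : ρ ≠ -ρ := fun h => hρ0 (by
    have h2 : (2 : ℂ) * ρ = 0 := by linear_combination h
    simpa using h2)
  have hval : ∀ t : K →+* ℂ, t (w : K) = ρ ∨ t (w : K) = -ρ := apply_eq_or_eq_neg_of_sq_eq_neg hw2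
  let S : ℂ → Set (K →+* ℂ) := fun ε => {t | t (w : K) = ε}
  have hSρ : ∀ s : K →+* ℂ, s ∈ S ρ ↔ ComplexEmbedding.conjugate s ∉ S ρ := by
    intro s
    show s (w : K) = ρ ↔ ¬ ComplexEmbedding.conjugate s (w : K) = ρ
    rw [conjugate_apply_eq_neg_of_sq_eq_neg hw2]
    constructor
    · intro h h'
      rw [h] at h'
      exact hρne h'.symm
    · intro h
      rcases hval s with h1 | h1
      · exact h1
      · exact absurd (by rw [h1, neg_neg]) h
  -- the counts: `|S ρ| = |Φ| = 6`, `|Φ ∩ S ρ| = 3`, hence `|Φ ∩ S(-ρ)| = |Φᶜ ∩ S ρ| = |Φᶜ ∩ S(-ρ)| = 3`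
  have hSρ6 : (S ρ).ncard = 6 := by have h := two_mul_ncard_of_transversal hSρ; rw [hK] at h; omega
  have hΦ6 : (Φ.1 : Set (K →+* ℂ)).ncard = 6 := by have h := two_mul_ncard_of_transversal Φ.2; rw [hK] at h; omega
  have hmult : (Φ.1 ∩ S ρ).ncard = 3 := by
    have h := eigenMultiplicity_eq_ncard_of_isCMTypeRealisation hA w ρ
    rw [hw, hm] at h
    exact h.symm
  have hunion : ∀ T : Set (K →+* ℂ), T = (T ∩ S ρ) ∪ (T ∩ S (-ρ)) := by
    intro T
    ext t
    simp only [Set.mem_union, Set.mem_inter_iff]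
    constructor
    · intro ht
      rcases hval t with h | h
      · exact Or.inl ⟨ht, h⟩
      · exact Or.inr ⟨ht, h⟩
    · rintro (⟨ht, -⟩ | ⟨ht, -⟩) <;> exact ht
  have hdisj : ∀ T T' : Set (K →+* ℂ), Disjoint (T ∩ S ρ) (T' ∩ S (-ρ)) := by
    intro T T'
    rw [Set.disjoint_left]
    rintro t ⟨-, h1⟩ ⟨-, h2⟩
    exact hρne (h1.symm.trans h2)
  have hsplit : ∀ T : Set (K →+* ℂ), T.ncard = (T ∩ S ρ).ncard + (T ∩ S (-ρ)).ncard := by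
    intro T
    conv_lhs => rw [hunion T]
    exact Set.ncard_union_eq (hdisj T T)
  have hunion' : ∀ ε : ℂ, S ε = (Φ.1 ∩ S ε) ∪ ((Φ.1)ᶜ ∩ S ε) := by
    intro ε
    rw [← Set.union_inter_distrib_right, Set.union_compl_self, Set.univ_inter]
  have hsplit' : ∀ ε : ℂ, (S ε).ncard = (Φ.1 ∩ S ε).ncard + ((Φ.1)ᶜ ∩ S ε).ncard := by
    intro ε
    conv_lhs => rw [hunion' ε]
    exact Set.ncard_union_eq
      (Set.disjoint_left.2 fun t ⟨h1, _⟩ ⟨h2, _⟩ => h2 h1)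
  have hcΦm : (Φ.1 ∩ S (-ρ)).ncard = 3 := by have h := hsplit Φ.1; rw [hΦ6, hmult] at h; omega
  have hcCp : ((Φ.1)ᶜ ∩ S ρ).ncard = 3 := by have h := hsplit' ρ; rw [hSρ6, hmult] at h; omega
  have hSm6 : (S (-ρ)).ncard = 6 := by
    have h := hsplit Set.univ
    rw [Set.univ_inter, Set.univ_inter, Set.ncard_univ, Nat.card_eq_fintype_card, card_embeddings_eq_twelve hK,
      hSρ6] at h
    omega
  have hcCm : ((Φ.1)ᶜ ∩ S (-ρ)).ncard = 3 := by have h := hsplit' (-ρ); rw [hSm6, hcΦm] at h; omega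
  have hcount : ∀ ε : ℂ, ε = ρ ∨ ε = -ρ →
      (Φ.1 ∩ S ε).ncard = 3 ∧ ((Φ.1)ᶜ ∩ S ε).ncard = 3 := by
    rintro ε (rfl | rfl)
    · exact ⟨hmult, hcCp⟩
    · exact ⟨hcΦm, hcCm⟩
  -- the balanced `6`-set `Δ = S ρ` as a Finset
  set Δ : Finset (K →+* ℂ) := Finset.univ.filter fun s : K →+* ℂ => s (w : K) = ρ with hΔ_def
  have hmemΔ : ∀ {s : K →+* ℂ}, s ∈ Δ ↔ s (w : K) = ρ := fun {s} => by simp [hΔ_def]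
  have hcoeΔ : (↑Δ : Set (K →+* ℂ)) = S ρ := by
    ext s
    rw [Finset.mem_coe, hmemΔ]
    rfl
  have hΔ6 : Δ.card = 6 := by rw [← Set.ncard_coe_finset, hcoeΔ, hSρ6]
  have hτρ : ∀ τ : ℂ ≃+* ℂ, τ ρ = ρ ∨ τ ρ = -ρ := by
    intro τ
    have h : (τ ρ) ^ 2 = ρ ^ 2 := by
      rw [← map_pow, hρ, I_mul_sqrt_sq, map_neg, map_natCast]
    exact sq_eq_sq_iff_eq_or_eq_neg.1 h
  have hbal : IsGaloisBalanced Φ Δ := by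
    intro τ
    -- `s ↦ τ ∘ s` carries `{s ∈ Δ | τs ∈ T}` onto `T ∩ S (τ ρ)`
    have key : ∀ T : Set (K →+* ℂ),
        (fun s : K →+* ℂ => (τ : ℂ →+* ℂ).comp s) '' {s : K →+* ℂ | s ∈ Δ ∧ (τ : ℂ →+* ℂ).comp s ∈ T} =
          T ∩ S (τ ρ) := by
      intro T
      ext t
      simp only [Set.mem_image, Set.mem_setOf_eq, Set.mem_inter_iff]
      constructor
      · rintro ⟨s, ⟨hsΔ, hsT⟩, rfl⟩
        refine ⟨hsT, ?_⟩
        show ((τ : ℂ →+* ℂ).comp s) (w : K) = τ ρ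
        rw [RingHom.comp_apply, hmemΔ.1 hsΔ]
        rfl
      · rintro ⟨htT, htw⟩
        have hcomp : (τ : ℂ →+* ℂ).comp ((τ.symm : ℂ →+* ℂ).comp t) = t := RingHom.ext fun x => by simp
        refine ⟨(τ.symm : ℂ →+* ℂ).comp t, ⟨hmemΔ.2 ?_, by rw [hcomp]; exact htT⟩, hcomp⟩
        rw [RingHom.comp_apply]
        show τ.symm (t (w : K)) = ρ
        have htw' : t (w : K) = τ ρ := htw
        rw [htw']
        exact τ.symm_apply_apply ρ
    have hinjτ : Function.Injective fun s : K →+* ℂ => (τ : ℂ →+* ℂ).comp s := fun s₁ s₂ h =>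
      RingHom.ext fun x => τ.injective (by
        have := congrArg (fun f : K →+* ℂ => f x) h
        simpa using this)
    have hP : {s : K →+* ℂ | s ∈ Δ ∧ (τ : ℂ →+* ℂ).comp s ∈ Φ.1}.ncard = (Φ.1 ∩ S (τ ρ)).ncard := by
      rw [← key Φ.1, Set.ncard_image_of_injective _ hinjτ]
    have hN : {s : K →+* ℂ | s ∈ Δ ∧ (τ : ℂ →+* ℂ).comp s ∉ Φ.1}.ncard = ((Φ.1)ᶜ ∩ S (τ ρ)).ncard := by
      rw [← key (Φ.1)ᶜ, Set.ncard_image_of_injective _ hinjτ]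
      rfl
    obtain ⟨h1, h2⟩ := hcount (τ ρ) (hτρ τ)
    rw [hP, hN, h1, h2]
  have hΔmem : Δ ∈ pohlmannSets Φ 3 := ⟨by rw [hΔ6], hbal⟩
  -- `Δ` is not conjugation-closed
  have hΔne : Δ.Nonempty := by rw [← Finset.card_pos, hΔ6]; norm_num
  obtain ⟨s, hsΔ⟩ := hΔne
  have hsbar : ComplexEmbedding.conjugate s ∉ Δ := fun h => (hSρ s).1 (hmemΔ.1 hsΔ) (hmemΔ.1 h)
  -- an exceptional class in `H⁶`, so `B³ ≠ D³`: the type is degenerate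
  obtain ⟨c, hcQ, hcH, hcD⟩ := (exists_exceptional_iff_of_primitive hA hprim' 3).2 ⟨Δ, hΔmem, s, hsΔ, hsbar⟩
  intro hΦ
  exact hcD (hΦ.hodgeClassSpan_eq_divisorClassesSpan hA 3 ▸ Submodule.subset_span ⟨hcQ, hcH⟩)

/-- **`HasBalancedQuadraticEndomorphism A ⟺ Φ degenerate`** on every realisation of a primitive CM type of a CM field
of degree `12`. [cite: MoonenZarhin1999LowDim, §5] [cite: Gordon1999HodgeAVSurvey, 5.13 and 9.4] -/
theorem hasBalancedQuadraticEndomorphism_iff_not_isNondegenerate (hK : Module.finrank ℚ K = 12) (φ₀ : K →+* ℂ)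
    (hprim : IsPrimitive (ℂ ≃+* ℂ) Φ.1 φ₀) (hA : IsCMTypeRealisation Φ A ι θ) :
    HasBalancedQuadraticEndomorphism A ↔ ¬ IsNondegenerate Φ :=
  ⟨not_isNondegenerate_of_hasBalancedQuadraticEndomorphism hK φ₀ hprim hA,
    hasBalancedQuadraticEndomorphism_of_not_isNondegenerate hK φ₀ hprim hA⟩

/-- **`B(A) = D(A) ⟺ ¬ HasBalancedQuadraticEndomorphism A`** on every realisation of a primitive CM type of a CM
field of degree `12`. [cite: Gordon1999HodgeAVSurvey, 5.13 (i)–(ii)] [cite: MoonenZarhin1999LowDim, §5] -/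
theorem isDivisorGenerated_iff_not_hasBalancedQuadraticEndomorphism_of_isCMTypeRealisation
    (hK : Module.finrank ℚ K = 12) (φ₀ : K →+* ℂ) (hprim : IsPrimitive (ℂ ≃+* ℂ) Φ.1 φ₀)
    (hA : IsCMTypeRealisation Φ A ι θ) : IsDivisorGenerated A ↔ ¬ HasBalancedQuadraticEndomorphism A := by
  rw [isDivisorGenerated_iff_isNondegenerate_of_finrank_eq_twelve hK φ₀ hprim hA,
    hasBalancedQuadraticEndomorphism_iff_not_isNondegenerate hK φ₀ hprim hA, not_not]

end Degenerate

/-! ### §3 On the variety: the trichotomy for simple CM sixfolds -/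

section Sixfold

variable {X : AbelianVariety ℂ}

/-- **`B(X) = D(X) ⟺ X has no balanced quadratic endomorphism`**, for a simple complex abelian SIXFOLD of CM type —
Moonen–Zarhin's fourfold theorem 2.4 in dimension `6`, on the variety: `X` supports exceptional Hodge classes iff
`End⁰(X)` contains an imaginary quadratic field acting with multiplicities `(3, 3)`. [cite: MoonenZarhin1995Duke, Thm. 2.4]
[cite: MoonenZarhin1999LowDim, §5] [cite: Gordon1999HodgeAVSurvey, 5.13 and Thm. 6.4] -/
theorem isDivisorGenerated_iff_not_hasBalancedQuadraticEndomorphism (hs : X.IsSimple) (hX6 : X.dim = 6)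
    (hcm : IsOfCMType X) : IsDivisorGenerated X ↔ ¬ HasBalancedQuadraticEndomorphism X := by
  obtain ⟨K, _, _, _, Φ, X', ι, θ, s₀, hA, hK, hprim, hiso⟩ :=
    exists_isCMTypeRealisation_of_isSimpleCMSixfold X ⟨hX6, hs, hcm⟩
  rw [isDivisorGenerated_iff_of_isIsogenous hiso,
    isDivisorGenerated_iff_not_hasBalancedQuadraticEndomorphism_of_isCMTypeRealisation hK s₀ hprim hA,
    hasBalancedQuadraticEndomorphism_iff_of_isIsogenous hiso]

/-- **All powers divisor-generated ⟺ no balanced quadratic endomorphism** (Hazama's criterion for simple CM sixfolds in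
terms of the endomorphism algebra). [cite: Gordon1999HodgeAVSurvey, Thm. 6.4 and 5.13] [cite: MoonenZarhin1999LowDim, §5] -/
theorem forall_isDivisorGenerated_powSucc_iff_not_hasBalancedQuadraticEndomorphism (hs : X.IsSimple)
    (hX6 : X.dim = 6) (hcm : IsOfCMType X) :
    (∀ N : ℕ, IsDivisorGenerated (X.powSucc N)) ↔ ¬ HasBalancedQuadraticEndomorphism X := by
  rw [← isDivisorGenerated_iff_forall_powSucc_of_dim_six hs hX6 hcm,
    isDivisorGenerated_iff_not_hasBalancedQuadraticEndomorphism hs hX6 hcm]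

/-- **Exceptional classes in `H⁶(X)` ⟺ a balanced quadratic endomorphism**, for a simple CM sixfold.
[cite: MoonenZarhin1995Duke, Thm. 2.4] [cite: MoonenZarhin1999LowDim, §5] -/
theorem hasBalancedQuadraticEndomorphism_iff_exists_exceptional_three (hs : X.IsSimple) (hX6 : X.dim = 6)
    (hcm : IsOfCMType X) :
    HasBalancedQuadraticEndomorphism X ↔
      ∃ c : complexBetti X.X (2 * 3), IsRationalClass c ∧ IsOfHodgeType X.dim X.X (2 * 3) 3 3 c ∧
        c ∉ divisorClassesSpan X.X X.dim 3 := by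
  rw [← not_iff_not, ← isDivisorGenerated_iff_not_hasBalancedQuadraticEndomorphism hs hX6 hcm]
  simp only [not_exists, not_and, not_not]
  constructor
  · intro h c hc hpp
    exact h 3 c hc hpp
  · intro h p c hc hpp
    by_cases hp : p = 3
    · subst hp; exact h c hc hpp
    · exact mem_divisorClassesSpan_of_ne_three_of_dim_six hs hX6 hcm hp c hc hpp

variable [HodgeTensorFacts.{0, 0}] {n : ℕ} (hXn : IsSmoothProjective n X.X)

/-- **`dim MT(H¹(X)) = 6 ⟺ X has a balanced quadratic endomorphism`** (and `= 7` otherwise), for a simple CM sixfold.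
[cite: Gordon1999HodgeAVSurvey, 9.4 and 5.13] [cite: MoonenZarhin1999LowDim, §5] -/
theorem hasBalancedQuadraticEndomorphism_iff_mtRank_eq_six (hs : X.IsSimple) (hX6 : X.dim = 6)
    (hcm : IsOfCMType X) :
    haveI := BettiUniverse.finite hXn 1
    HasBalancedQuadraticEndomorphism X ↔ (BettiUniverse.hodge exists_isReal_hodgeModel_holds hXn 1).mtRank = 6 := by
  refine ⟨fun h => ?_, hasBalancedQuadraticEndomorphism_of_mtRank_eq_six hXn hs hX6 hcm⟩
  rcases mtRank_hodge_one_eq_six_or_seven_of_dim_six hXn hs hX6 hcm with h6 | h7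
  · exact h6
  · exact absurd ((isDivisorGenerated_iff_mtRank_eq_seven_of_dim_six hXn hs hX6 hcm).2 h7)
      ((isDivisorGenerated_iff_not_hasBalancedQuadraticEndomorphism hs hX6 hcm).not.2 (not_not.2 h))

end Sixfold

end Summit.HodgeConjecture.CorCM.CMSixfoldRank

end
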